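import Summits.ABC.ABC.Cruxes.PrimePowerRadical.Disproof

/-!
# Sketch (crux-ideate r1, ideator 2 / gen 2) — card `adelic-brjuno-summability`, crux stmt-ABC-1648

Crux: `Summit.ABC.ABC.Theses.IneffectiveSubspace.PrimePowerRadical`.
Everything is over existing declarations: `Disproof.{PPRAt, WieferichSparse, wieferichLevel, oddWieferichExcess,
ordMod, PPRAt_iff_wieferichSparse, dvd_pow_sub_one_iff_ordMod_dvd, ordMod_pos, not_dvd_base_of_dvd, two_le_pow}`,
`Literature.NumberTheory.DiophantineGeometry.{rad, IsWieferich}`, Mathlib (`Summable`, `tsum`, `Filter.cofinite`, …).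

Notation: for an odd prime `p ∤ q`, `d_p := ordMod q p` (multiplicative order), `W_p := wieferichLevel q p`
(`≥ 2` iff `p` is Wieferich to base `q`), and the RENORMALISED `p`-ADIC BRJUNO ATOM of `q`
  `c_p := atom q p := (W_p − 1) · log p / d_p`   (zero unless `p ∈ W_q`).
Dictionary (Di Vizio, Invent. Math. 150 (2002) = arXiv:math/0104178, intro p. 3): `(κ_p, ℓ_p) = (d_p, W_p)` are "the
arithmetical counterpart of the problem of small divisors"; `|[n]_q!|_p = |[κ_p]_q|_p^{⌊n/κ_p⌋}|⌊n/κ_p⌋!|_p` (her Lemma,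
p. 8), so `Σ_p c_p` is the excess, over the generic level `W_p = 1`, of the sum over finite places of
`log(1/radius of convergence)` of the `q`-exponential — a renormalised ADELIC BRJUNO SUM `T_q` of the rational number `q`.

PROVED here (kernel-checked, no sorry; `lean check` rc 0):
* `wieferichSparse_of_wdc`      — `T_q < ∞ ⟹ WieferichSparse q`   (the lever: dominated convergence / M-splitting);
* `primePowerRadical_of_wdc`    — `(∀ q prime, T_q < ∞) ⟹ PrimePowerRadical` (concludes the crux BY NAME);
* `atom_tendsto_zero_of_wieferichSparse`, `atom_tendsto_zero_of_PPRAt`, `primePowerRadical_imp_atom_tendsto_zero`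
                                — the crux at `q` forces `c_p → 0` along the primes.
* `log_oddWieferichExcess_eq_sum_levelExcess`, `wieferichSparse_iff_tendsto`, `PPRAt_iff_levelAverage`
                                — the exact `k`-side identity `log E_W(q,k) = Σ_{d∣k} E_q(d)` and the `μ_k` reformulation.
So:   `(c_p)_p ∈ c₀  ⟸  crux(q)  ⟸  (c_p)_p ∈ ℓ¹`   — THE SANDWICH;  crux(q) ⟺ `(1/k)Σ_{d∣k}E_q(d) → 0`.
* `linearLoss_iff_finite_wieferich` — LINEAR LOSS ⟺ FINITELY MANY WIEFERICH PRIMES (the `A = 1` end of `Disproof` §7).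
TYPED (sorried) below: Romanoff-type expectation theorem `romanoff_log`, the intermediate dial `excess_littleO_of_summable_pow`.
-/

noncomputable section

set_option linter.dupNamespace false

namespace Summit.ABC.ABC.Cruxes.PrimePowerRadical.Brjuno

open Literature.NumberTheory.DiophantineGeometry UniqueFactorizationMonoid
open Summit.ABC.ABC.Theses.IneffectiveSubspace
open Summit.ABC.ABC.Cruxes.PrimePowerRadical.Disproof
open scoped BigOperators


/-- The renormalised `p`-adic Brjuno atom of `q`: `(W_p(q) − 1)·log p / ord_p(q)`. -/
def atom (q p : ℕ) : ℝ :=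
  ((wieferichLevel q p - 1 : ℕ) : ℝ) * Real.log p / (ordMod q p : ℝ)

theorem atom_nonneg (q p : ℕ) : 0 ≤ atom q p := by
  unfold atom
  apply div_nonneg
  · exact mul_nonneg (Nat.cast_nonneg _) (Real.log_natCast_nonneg p)
  · exact Nat.cast_nonneg _

/-- `WDC q`: the renormalised adelic Brjuno sum of `q` converges. -/
def WDC (q : ℕ) : Prop := Summable (fun p : Nat.Primes => atom q p)

/-- `log E_W(q,k)` as a sum over the odd primes of `q^k − 1`. -/
theorem log_oddWieferichExcess_eq (q k : ℕ) :
    Real.log (oddWieferichExcess q k) =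
      ∑ p ∈ (q ^ k - 1).primeFactors.erase 2, ((wieferichLevel q p - 1 : ℕ) : ℝ) * Real.log p := by
  unfold oddWieferichExcess
  rw [Nat.cast_prod, Real.log_prod]
  · apply Finset.sum_congr rfl
    intro p _
    rw [Nat.cast_pow, Real.log_pow]
  · intro p hp
    have hpr : p.Prime := Nat.prime_of_mem_primeFactors (Finset.mem_of_mem_erase hp)
    exact_mod_cast (pow_pos hpr.pos _).ne'

/-- For an odd prime `p ∣ q^k − 1`: the summand equals `atom · ord`. -/
theorem summand_eq_atom_mul {q k p : ℕ} (hq : 2 ≤ q) (hk : 1 ≤ k) (hp : p.Prime)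
    (hpk : p ∣ q ^ k - 1) :
    ((wieferichLevel q p - 1 : ℕ) : ℝ) * Real.log p = atom q p * (ordMod q p : ℝ) := by
  have hpq : ¬ p ∣ q := not_dvd_base_of_dvd hp hk (by omega) hpk
  have hd : 0 < ordMod q p := ordMod_pos hp hpq
  have hd0 : (ordMod q p : ℝ) ≠ 0 := by exact_mod_cast hd.ne'
  unfold atom
  rw [div_mul_cancel₀ _ hd0]

/-- THE LEVER: `T_q < ∞ ⟹ WieferichSparse q` (dominated convergence / `M`-splitting). -/
theorem wieferichSparse_of_wdc {q : ℕ} (hq : q.Prime) (h : WDC q) : WieferichSparse q := by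
  have hq2 := hq.two_le
  have hq0 : (0 : ℝ) < q := by exact_mod_cast hq.pos
  have hq1 : (1 : ℝ) < q := by exact_mod_cast hq.one_lt
  have hlogq : 0 < Real.log q := Real.log_pos hq1
  -- transport the summable function to ℕ via the indicator of the primes
  set G : ℕ → ℝ := (setOf Nat.Prime).indicator (atom q) with hG
  have hGsum : Summable G := by
    rw [hG, ← summable_subtype_iff_indicator]
    exact h
  have hG0 : ∀ n, 0 ≤ G n := by
    intro n
    exact Set.indicator_nonneg (fun i _ => atom_nonneg q i) n
  have hGp : ∀ p : ℕ, p.Prime → G p = atom q p := by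
    intro p hp
    exact Set.indicator_of_mem (show p ∈ setOf Nat.Prime from hp) _
  set T : ℝ := ∑' n, G n with hT
  have hT0 : 0 ≤ T := tsum_nonneg hG0
  intro δ hδ
  -- the two halves of the budget
  set c : ℝ := δ * Real.log q / 2 with hc
  have hc0 : 0 < c := by positivity
  -- choose M with T / M ≤ c
  set M : ℕ := ⌈T / c⌉₊ + 1 with hM
  have hMpos : 0 < M := by omega
  have hMR : (0 : ℝ) < M := by exact_mod_cast hMpos
  have hTM : T / M ≤ c := by
    rw [div_le_iff₀ hMR]
    have h1 : T / c ≤ ⌈T / c⌉₊ := Nat.le_ceil _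
    have h2 : (⌈T / c⌉₊ : ℝ) ≤ M := by rw [hM]; push_cast; linarith
    have h3 : T / c ≤ M := le_trans h1 h2
    rw [div_le_iff₀ hc0] at h3
    linarith
  -- vanishing set for the tail
  obtain ⟨F, hF⟩ := summable_iff_vanishing_norm.mp hGsum c hc0
  set y₀ : ℕ := F.sup (ordMod q) + 1 with hy₀
  set K₀ : ℕ := M * y₀ with hK₀
  -- core estimate for k ≥ K₀
  have core : ∀ k : ℕ, 1 ≤ k → K₀ ≤ k →
      Real.log (oddWieferichExcess q k) ≤ δ * k * Real.log q := by
    intro k hk hkK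
    set S := (q ^ k - 1).primeFactors.erase 2 with hS
    have hmemS : ∀ p ∈ S, p.Prime ∧ p ∣ q ^ k - 1 ∧ ¬ p ∣ q := by
      intro p hp
      have hpP := Finset.mem_of_mem_erase hp
      have hpr : p.Prime := Nat.prime_of_mem_primeFactors hpP
      have hpk : p ∣ q ^ k - 1 := Nat.dvd_of_mem_primeFactors hpP
      exact ⟨hpr, hpk, not_dvd_base_of_dvd hpr hk (by omega) hpk⟩
    have hdvdk : ∀ p ∈ S, ordMod q p ∣ k := by
      intro p hp
      obtain ⟨hpr, hpk, -⟩ := hmemS p hp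
      exact (dvd_pow_sub_one_iff_ordMod_dvd hpr (by omega) k).mp hpk
    rw [log_oddWieferichExcess_eq, ← hS]
    -- rewrite summands as atom * ord
    have hre : ∑ p ∈ S, ((wieferichLevel q p - 1 : ℕ) : ℝ) * Real.log p
        = ∑ p ∈ S, atom q p * (ordMod q p : ℝ) := by
      apply Finset.sum_congr rfl
      intro p hp
      obtain ⟨hpr, hpk, -⟩ := hmemS p hp
      exact summand_eq_atom_mul hq2 hk hpr hpk
    rw [hre]
    -- split at ord * M ≤ k
    rw [← Finset.sum_filter_add_sum_filter_not S (fun p => ordMod q p * M ≤ k)]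
    set S₁ := S.filter (fun p => ordMod q p * M ≤ k) with hS₁
    set S₂ := S.filter (fun p => ¬ ordMod q p * M ≤ k) with hS₂
    -- first block
    have hB1 : ∑ p ∈ S₁, atom q p * (ordMod q p : ℝ) ≤ (k : ℝ) / M * T := by
      have h1 : ∑ p ∈ S₁, atom q p * (ordMod q p : ℝ) ≤ ∑ p ∈ S₁, atom q p * ((k : ℝ) / M) := by
        apply Finset.sum_le_sum
        intro p hp
        have hpd : ordMod q p * M ≤ k := (Finset.mem_filter.mp hp).2
        have hpd' : (ordMod q p : ℝ) ≤ (k : ℝ) / M := by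
          rw [le_div_iff₀ hMR]
          exact_mod_cast hpd
        exact mul_le_mul_of_nonneg_left hpd' (atom_nonneg q p)
      have h2 : ∑ p ∈ S₁, atom q p * ((k : ℝ) / M) = ((k : ℝ) / M) * ∑ p ∈ S₁, atom q p := by
        rw [Finset.mul_sum]
        apply Finset.sum_congr rfl
        intro p _
        ring
      have h3 : ∑ p ∈ S₁, atom q p = ∑ p ∈ S₁, G p := by
        apply Finset.sum_congr rfl
        intro p hp
        rw [hGp p (hmemS p (Finset.mem_filter.mp hp).1).1]
      have h4 : ∑ p ∈ S₁, G p ≤ T := hGsum.sum_le_tsum S₁ (fun i _ => hG0 i)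
      have hkM : 0 ≤ (k : ℝ) / M := by positivity
      calc ∑ p ∈ S₁, atom q p * (ordMod q p : ℝ)
          ≤ ∑ p ∈ S₁, atom q p * ((k : ℝ) / M) := h1
        _ = ((k : ℝ) / M) * ∑ p ∈ S₁, atom q p := h2
        _ = ((k : ℝ) / M) * ∑ p ∈ S₁, G p := by rw [h3]
        _ ≤ ((k : ℝ) / M) * T := mul_le_mul_of_nonneg_left h4 hkM
        _ = (k : ℝ) / M * T := rfl
    -- second block: disjoint from F, orders ≤ k
    have hdisj : Disjoint S₂ F := by
      rw [Finset.disjoint_left]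
      intro p hp2 hpF
      have hnot : ¬ ordMod q p * M ≤ k := (Finset.mem_filter.mp hp2).2
      have hle : ordMod q p ≤ F.sup (ordMod q) := Finset.le_sup hpF
      apply hnot
      calc ordMod q p * M ≤ F.sup (ordMod q) * M := Nat.mul_le_mul_right _ hle
        _ ≤ y₀ * M := Nat.mul_le_mul_right _ (by omega)
        _ = K₀ := by rw [hK₀, mul_comm]
        _ ≤ k := hkK
    have hB2 : ∑ p ∈ S₂, atom q p * (ordMod q p : ℝ) ≤ (k : ℝ) * c := by
      have h1 : ∑ p ∈ S₂, atom q p * (ordMod q p : ℝ) ≤ ∑ p ∈ S₂, atom q p * (k : ℝ) := by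
        apply Finset.sum_le_sum
        intro p hp
        have hpS : p ∈ S := (Finset.mem_filter.mp hp).1
        have hdk : ordMod q p ≤ k := Nat.le_of_dvd (by omega) (hdvdk p hpS)
        have hdk' : (ordMod q p : ℝ) ≤ k := by exact_mod_cast hdk
        exact mul_le_mul_of_nonneg_left hdk' (atom_nonneg q p)
      have h2 : ∑ p ∈ S₂, atom q p * (k : ℝ) = (k : ℝ) * ∑ p ∈ S₂, G p := by
        rw [Finset.mul_sum]
        apply Finset.sum_congr rfl
        intro p hp
        rw [hGp p (hmemS p (Finset.mem_filter.mp hp).1).1]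
        ring
      have h3 : ∑ p ∈ S₂, G p ≤ c := by
        have := hF S₂ hdisj
        rw [Real.norm_eq_abs] at this
        have := (abs_lt.mp this).2
        linarith
      have hk0 : (0 : ℝ) ≤ k := Nat.cast_nonneg _
      calc ∑ p ∈ S₂, atom q p * (ordMod q p : ℝ)
          ≤ ∑ p ∈ S₂, atom q p * (k : ℝ) := h1
        _ = (k : ℝ) * ∑ p ∈ S₂, G p := h2
        _ ≤ (k : ℝ) * c := mul_le_mul_of_nonneg_left h3 hk0
    -- combine
    have hk0 : (0 : ℝ) ≤ k := Nat.cast_nonneg _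
    have hB1' : (k : ℝ) / M * T ≤ (k : ℝ) * c := by
      have : (k : ℝ) / M * T = (k : ℝ) * (T / M) := by ring
      rw [this]
      exact mul_le_mul_of_nonneg_left hTM hk0
    calc ∑ p ∈ S₁, atom q p * (ordMod q p : ℝ) + ∑ p ∈ S₂, atom q p * (ordMod q p : ℝ)
        ≤ (k : ℝ) * c + (k : ℝ) * c := add_le_add (le_trans hB1 hB1') hB2
      _ = δ * k * Real.log q := by rw [hc]; ring
  -- assemble the constant
  set B : ℝ := (∑ j ∈ Finset.range K₀, (oddWieferichExcess q j : ℝ)) + 2 with hB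
  have hBsum0 : 0 ≤ ∑ j ∈ Finset.range K₀, (oddWieferichExcess q j : ℝ) :=
    Finset.sum_nonneg fun j _ => Nat.cast_nonneg _
  have hB1 : 1 < B := by rw [hB]; linarith
  have hB0 : 0 < B := by linarith
  refine ⟨B, hB0, fun k hk => ?_⟩
  have hQ1 : (1 : ℝ) ≤ (q : ℝ) ^ (δ * k) := Real.one_le_rpow hq1.le (by positivity)
  have hQ0 : (0 : ℝ) < (q : ℝ) ^ (δ * k) := by positivity
  by_cases hkK : K₀ ≤ k
  · -- large k: E_W ≤ q^(δ k) < B q^(δ k)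
    have hE0 : (0 : ℝ) < oddWieferichExcess q k := by exact_mod_cast oddWieferichExcess_pos q k
    have hlog := core k hk hkK
    have hE : (oddWieferichExcess q k : ℝ) ≤ (q : ℝ) ^ (δ * k) := by
      have h1 : (oddWieferichExcess q k : ℝ) = Real.exp (Real.log (oddWieferichExcess q k)) :=
        (Real.exp_log hE0).symm
      have h2 : (q : ℝ) ^ (δ * k) = Real.exp (Real.log q * (δ * k)) := Real.rpow_def_of_pos hq0 _
      rw [h1, h2]
      apply Real.exp_le_exp.mpr
      have : Real.log q * (δ * k) = δ * k * Real.log q := by ring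
      rw [this]
      exact hlog
    calc (oddWieferichExcess q k : ℝ) ≤ (q : ℝ) ^ (δ * k) := hE
      _ = 1 * (q : ℝ) ^ (δ * k) := (one_mul _).symm
      _ < B * (q : ℝ) ^ (δ * k) := mul_lt_mul_of_pos_right hB1 hQ0
  · -- small k: E_W(q,k) ≤ Σ_{j<K₀} E_W < B ≤ B q^(δ k)
    have hkmem : k ∈ Finset.range K₀ := Finset.mem_range.mpr (by omega)
    have hle : (oddWieferichExcess q k : ℝ) ≤ ∑ j ∈ Finset.range K₀, (oddWieferichExcess q j : ℝ) :=
      Finset.single_le_sum (fun j _ => Nat.cast_nonneg _) hkmem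
    calc (oddWieferichExcess q k : ℝ) ≤ ∑ j ∈ Finset.range K₀, (oddWieferichExcess q j : ℝ) := hle
      _ < B := by rw [hB]; linarith
      _ ≤ B * (q : ℝ) ^ (δ * k) := le_mul_of_one_le_right hB0.le hQ1

/-- Hence `WDC` at every prime base gives the crux BY NAME. -/
theorem primePowerRadical_of_wdc (h : ∀ q : ℕ, q.Prime → WDC q) : PrimePowerRadical := by
  intro q hq
  exact (PPRAt_iff_wieferichSparse hq).mpr (wieferichSparse_of_wdc hq (h q hq))


/-- Primes of small multiplicative order are few: if `p` is prime, `p ∤ q`... more simply, every prime `p`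
with `p ∣ q^d − 1` for some `1 ≤ d < Y` is at most `∏_{d<Y} (q^d − 1)·…`; we only need a crude bound. -/
theorem prime_le_of_ordMod_lt {q p Y : ℕ} (hq : 2 ≤ q) (hp : p.Prime) (hpq : ¬ p ∣ q)
    (hY : ordMod q p < Y) : p ≤ ∏ d ∈ Finset.Ico 1 Y, (q ^ d - 1) := by
  have hd : 0 < ordMod q p := ordMod_pos hp hpq
  have hpd : p ∣ q ^ ordMod q p - 1 := (dvd_pow_sub_one_iff_ordMod_dvd hp (by omega) _).mpr dvd_rfl
  have hmem : ordMod q p ∈ Finset.Ico 1 Y := Finset.mem_Ico.mpr ⟨hd, hY⟩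
  have hdvd : p ∣ ∏ d ∈ Finset.Ico 1 Y, (q ^ d - 1) :=
    dvd_trans hpd (Finset.dvd_prod_of_mem _ hmem)
  have hpos : 0 < ∏ d ∈ Finset.Ico 1 Y, (q ^ d - 1) := by
    apply Finset.prod_pos
    intro d hdm
    have hd1 : 1 ≤ d := (Finset.mem_Ico.mp hdm).1
    have := two_le_pow hq hd1
    omega
  exact Nat.le_of_dvd hpos hdvd

/-- NECESSARY direction of the sandwich: the crux at `q` forces the atoms to tend to `0`. -/
theorem atom_tendsto_zero_of_wieferichSparse {q : ℕ} (hq : q.Prime) (h : WieferichSparse q) :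
    Filter.Tendsto (fun p : Nat.Primes => atom q p) Filter.cofinite (nhds 0) := by
  have hq2 := hq.two_le
  have hq0 : (0 : ℝ) < q := by exact_mod_cast hq.pos
  have hq1 : (1 : ℝ) < q := by exact_mod_cast hq.one_lt
  have hlogq : 0 < Real.log q := Real.log_pos hq1
  rw [Metric.tendsto_nhds]
  intro ε hε
  -- WieferichSparse with defect ε₁ = ε / (2 log q)
  set ε₁ : ℝ := ε / (2 * Real.log q) with hε₁
  have hε₁0 : 0 < ε₁ := by positivity
  obtain ⟨C, hC, hCk⟩ := h ε₁ hε₁0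
  -- threshold on the order: log C / d < ε/2 once d > Y₀
  set Y : ℕ := ⌈2 * |Real.log C| / ε⌉₊ + 1 with hY
  set N : ℕ := ∏ d ∈ Finset.Ico 1 Y, (q ^ d - 1) with hN
  -- the exceptional set is contained in {p ≤ max N q} ∪ {2}
  rw [Filter.eventually_cofinite]
  apply Set.Finite.subset (s := {p : Nat.Primes | (p : ℕ) ≤ max (max N q) 2})
  · apply Set.Finite.of_finite_image (f := fun p : Nat.Primes => (p : ℕ))
    · apply Set.Finite.subset (Set.finite_Iic (max (max N q) 2))
      rintro n ⟨p, hp, rfl⟩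
      exact hp
    · exact Subtype.val_injective.injOn
  · intro p hp
    simp only [Set.mem_setOf_eq, not_lt] at hp
    simp only [Set.mem_setOf_eq]
    -- hp : ε ≤ dist (atom q p) 0 ; show p small
    have hpr : (p : ℕ).Prime := p.2
    by_contra hbig
    push_neg at hbig
    have hp2 : (p : ℕ) ≠ 2 := by omega
    have hpq' : ¬ (p : ℕ) ∣ q := by
      intro hdvd
      have := Nat.le_of_dvd hq.pos hdvd
      omega
    have hpN : N < (p : ℕ) := by omega
    -- atom ≥ ε
    have hat : ε ≤ atom q p := by
      rw [Real.dist_eq, sub_zero, abs_of_nonneg (atom_nonneg q p)] at hp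
      exact hp
    -- the level is ≥ 2 (else atom = 0)
    set d := ordMod q p with hdd
    have hd : 0 < d := ordMod_pos hpr hpq'
    have hdR : (0 : ℝ) < d := by exact_mod_cast hd
    -- order is large: d ≥ Y (else p ≤ N)
    have hdY : Y ≤ d := by
      by_contra hlt
      push_neg at hlt
      have := prime_le_of_ordMod_lt hq2 hpr hpq' hlt
      omega
    -- from WieferichSparse at k = d:  (W-1) log p ≤ log C + ε₁ d log q
    have hpd : (p : ℕ) ∣ q ^ d - 1 := (dvd_pow_sub_one_iff_ordMod_dvd hpr (by omega) _).mpr dvd_rfl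
    have hmem : (p : ℕ) ∈ (q ^ d - 1).primeFactors.erase 2 := by
      refine Finset.mem_erase.mpr ⟨hp2, ?_⟩
      have hn : q ^ d - 1 ≠ 0 := by have := two_le_pow hq2 hd; omega
      exact Nat.mem_primeFactors.mpr ⟨hpr, hpd, hn⟩
    have hpowdvd : (p : ℕ) ^ (wieferichLevel q p - 1) ∣ oddWieferichExcess q d := by
      unfold oddWieferichExcess
      exact Finset.dvd_prod_of_mem (fun r => r ^ (wieferichLevel q r - 1)) hmem
    have hE0 : 0 < oddWieferichExcess q d := oddWieferichExcess_pos q d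
    have hpowle : (p : ℕ) ^ (wieferichLevel q p - 1) ≤ oddWieferichExcess q d := Nat.le_of_dvd hE0 hpowdvd
    have hEk := hCk d hd
    -- real logs
    have hp0 : (0 : ℝ) < (p : ℕ) := by exact_mod_cast hpr.pos
    have h1 : ((wieferichLevel q p - 1 : ℕ) : ℝ) * Real.log p ≤ Real.log (oddWieferichExcess q d) := by
      have : Real.log (((p : ℕ) : ℝ) ^ (wieferichLevel q p - 1)) ≤ Real.log (oddWieferichExcess q d) := by
        apply Real.log_le_log (pow_pos hp0 _)
        exact_mod_cast hpowle
      rwa [Real.log_pow] at this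
    have hE0R : (0 : ℝ) < oddWieferichExcess q d := by exact_mod_cast hE0
    have h2 : Real.log (oddWieferichExcess q d) < Real.log C + ε₁ * d * Real.log q := by
      have := Real.log_lt_log hE0R hEk
      rw [Real.log_mul hC.ne' (Real.rpow_pos_of_pos hq0 _).ne', Real.log_rpow hq0] at this
      linarith
    -- atom = (W-1) log p / d < log C / d + ε₁ log q ≤ |log C| / Y + ε/2 < ε
    have h3 : atom q p * d < Real.log C + ε₁ * d * Real.log q := by
      have : atom q p * d = ((wieferichLevel q p - 1 : ℕ) : ℝ) * Real.log p := by
        unfold atom; rw [← hdd]; rw [div_mul_cancel₀ _ hdR.ne']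
      rw [this]; linarith
    have h4 : atom q p < Real.log C / d + ε₁ * Real.log q := by
      have key : atom q p * d < (Real.log C / d + ε₁ * Real.log q) * d := by
        rw [add_mul, div_mul_cancel₀ _ hdR.ne']
        have e : ε₁ * (d : ℝ) * Real.log q = ε₁ * Real.log q * d := by ring
        linarith [h3, e]
      exact lt_of_mul_lt_mul_right key hdR.le
    have h5 : ε₁ * Real.log q = ε / 2 := by
      rw [hε₁]; field_simp
    have hYR : (0 : ℝ) < Y := by exact_mod_cast (show 0 < Y by omega)
    have h6 : Real.log C / d ≤ |Real.log C| / Y := by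
      have hdY' : (Y : ℝ) ≤ d := by exact_mod_cast hdY
      calc Real.log C / d ≤ |Real.log C| / d := by
            apply div_le_div_of_nonneg_right (le_abs_self _) hdR.le
        _ ≤ |Real.log C| / Y := by
            apply div_le_div_of_nonneg_left (abs_nonneg _) hYR hdY'
    have h7 : |Real.log C| / Y < ε / 2 := by
      rw [div_lt_iff₀ hYR]
      have hc1 : 2 * |Real.log C| / ε ≤ ⌈2 * |Real.log C| / ε⌉₊ := Nat.le_ceil _
      have hc2 : (⌈2 * |Real.log C| / ε⌉₊ : ℝ) < Y := by
        rw [hY]; push_cast; linarith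
      have hc3 : 2 * |Real.log C| / ε < Y := lt_of_le_of_lt hc1 hc2
      rw [div_lt_iff₀ hε] at hc3
      linarith
    linarith


/-- The crux at `q` (all `ε`) forces the atoms to tend to zero. -/
theorem atom_tendsto_zero_of_PPRAt {q : ℕ} (hq : q.Prime) (h : ∀ ε : ℝ, 0 < ε → PPRAt q ε) :
    Filter.Tendsto (fun p : Nat.Primes => atom q p) Filter.cofinite (nhds 0) :=
  atom_tendsto_zero_of_wieferichSparse hq ((PPRAt_iff_wieferichSparse hq).mp h)

/-- `PrimePowerRadical ⟹` at every prime base the renormalised Brjuno atoms tend to zero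
(equivalently: for every `θ > 0` only finitely many Wieferich primes `p` to base `q` have
`(W_p − 1) log p > θ · ord_p(q)` — "no giants", cf. `NoGiantWieferich` of card lte-wieferich-transfer). -/
theorem primePowerRadical_imp_atom_tendsto_zero (h : PrimePowerRadical) (q : ℕ) (hq : q.Prime) :
    Filter.Tendsto (fun p : Nat.Primes => atom q p) Filter.cofinite (nhds 0) :=
  atom_tendsto_zero_of_PPRAt hq (h q hq)

/-! ## Typed, not yet proved (stubs / support for crux-plan) -/

/-- ROMANOFF-TYPE EXPECTATION THEOREM (provable now, elementary; Romanoff 1934 `Σ 1/(p·ord_p 2) < ∞`,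
Erdős–Turán 1935, Murty–Rosen–Silverman 1996 for variants): the Brjuno weights are summable against the
Wieferich DENSITY `1/p`:  `Σ_p log p / (p · ord_p(q)) < ∞`.  (Proof sketch: all primes with `ord_p(q) < Y` divide
`∏_{d<Y}(q^d − 1) < q^{Y²}`, so there are `< Y² log₂ q` of them — `prime_le_of_ordMod_lt` above is the pointwise form;
then dyadic blocks in the order.) Hence `T_q < ∞` almost surely in the independent `1/p` model of `W_q`. -/
theorem romanoff_log {q : ℕ} (hq : 2 ≤ q) :
    Summable (fun p : Nat.Primes => Real.log p / ((p : ℝ) * (ordMod q p : ℝ))) := by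
  sorry

/-- Level excess `E_q(d) := Σ_{p odd, p ∣ q^d − 1, ord_p(q) = d} (W_p − 1) log p`
(the Wieferich mass charged to the cyclotomic level `d`; `= 0` unless `d ∈ wieferichOrders q d`). -/
def levelExcess (q d : ℕ) : ℝ :=
  ∑ p ∈ ((q ^ d - 1).primeFactors.erase 2).filter (fun p => ordMod q p = d),
    ((wieferichLevel q p - 1 : ℕ) : ℝ) * Real.log p

/-! EXACT `k`-SIDE IDENTITY (PROVED): `log E_W(q,k) = Σ_{d ∣ k} E_q(d)`. Consequently
`(1/k) log E_W(q,k) = Σ_{d ∣ k} (φ(d)/k) · ε_q(d)` with `ε_q(d) := E_q(d)/φ(d)` — the AVERAGE of the level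
fractions under the law `μ_k(d) = φ(d)/k` of the additive order of a uniform random element of `ℤ/kℤ`
(`Nat.sum_totient`). The disprover's ORDER BUDGET (`Disproof` §12) is the crude bound `E_q(d) ≤ d log q`. -/

/-- The fibre of `ordMod q · = d` inside the odd primes of `q^k − 1` is the index set of `levelExcess q d`
whenever `d ∣ k`, `k ≥ 1`. -/
theorem fiber_eq {q k d : ℕ} (hq : 2 ≤ q) (hk : 1 ≤ k) (hd : d ∣ k) (hd1 : 1 ≤ d) :
    ((q ^ k - 1).primeFactors.erase 2).filter (fun p => ordMod q p = d) =
      ((q ^ d - 1).primeFactors.erase 2).filter (fun p => ordMod q p = d) := by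
  have hnk : q ^ k - 1 ≠ 0 := by have := two_le_pow hq hk; omega
  have hnd : q ^ d - 1 ≠ 0 := by have := two_le_pow hq hd1; omega
  ext p
  simp only [Finset.mem_filter, Finset.mem_erase, Nat.mem_primeFactors]
  constructor
  · rintro ⟨⟨hp2, hpr, hpk, -⟩, hpo⟩
    refine ⟨⟨hp2, hpr, ?_, hnd⟩, hpo⟩
    rw [dvd_pow_sub_one_iff_ordMod_dvd hpr (by omega), hpo]
  · rintro ⟨⟨hp2, hpr, hpd, -⟩, hpo⟩
    refine ⟨⟨hp2, hpr, ?_, hnk⟩, hpo⟩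
    rw [dvd_pow_sub_one_iff_ordMod_dvd hpr (by omega), hpo]
    exact hd

/-- EXACT `k`-SIDE IDENTITY: `log E_W(q,k) = Σ_{d ∣ k} E_q(d)`. -/
theorem log_oddWieferichExcess_eq_sum_levelExcess {q k : ℕ} (hq : q.Prime) (hk : 1 ≤ k) :
    Real.log (oddWieferichExcess q k) = ∑ d ∈ k.divisors, levelExcess q d := by
  have hq2 := hq.two_le
  rw [log_oddWieferichExcess_eq]
  set S := (q ^ k - 1).primeFactors.erase 2 with hS
  have hmaps : ∀ p ∈ S, ordMod q p ∈ k.divisors := by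
    intro p hp
    have hpP := Finset.mem_of_mem_erase hp
    have hpr : p.Prime := Nat.prime_of_mem_primeFactors hpP
    have hpk : p ∣ q ^ k - 1 := Nat.dvd_of_mem_primeFactors hpP
    exact Nat.mem_divisors.mpr ⟨(dvd_pow_sub_one_iff_ordMod_dvd hpr (by omega) k).mp hpk, by omega⟩
  rw [← Finset.sum_fiberwise_of_maps_to hmaps]
  apply Finset.sum_congr rfl
  intro d hdk
  have hd : d ∣ k := Nat.dvd_of_mem_divisors hdk
  have hd1 : 1 ≤ d := Nat.pos_of_mem_divisors hdk
  unfold levelExcess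
  rw [← fiber_eq hq2 hk hd hd1]


/-- `WieferichSparse q ⟺ (log E_W(q,k))/k → 0`. -/
theorem wieferichSparse_iff_tendsto {q : ℕ} (hq : q.Prime) :
    WieferichSparse q ↔
      Filter.Tendsto (fun k : ℕ => Real.log (oddWieferichExcess q k) / (k : ℝ)) Filter.atTop (nhds 0) := by
  have hq0 : (0 : ℝ) < q := by exact_mod_cast hq.pos
  have hq1 : (1 : ℝ) < q := by exact_mod_cast hq.one_lt
  have hlogq : 0 < Real.log q := Real.log_pos hq1
  have hE0 : ∀ k, (0 : ℝ) < oddWieferichExcess q k := fun k => by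
    exact_mod_cast oddWieferichExcess_pos q k
  have hE1 : ∀ k, (1 : ℝ) ≤ oddWieferichExcess q k := fun k => by
    exact_mod_cast oddWieferichExcess_pos q k
  have hlog0 : ∀ k, 0 ≤ Real.log (oddWieferichExcess q k) := fun k => Real.log_nonneg (hE1 k)
  constructor
  · intro h
    rw [Metric.tendsto_atTop]
    intro ε hε
    obtain ⟨C, hC, hCk⟩ := h (ε / (2 * Real.log q)) (by positivity)
    -- N with log C / N < ε / 2
    obtain ⟨N, hN⟩ := exists_nat_gt (2 * |Real.log C| / ε)
    refine ⟨N + 1, fun k hk => ?_⟩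
    have hk1 : 1 ≤ k := by omega
    have hkR : (0 : ℝ) < k := by exact_mod_cast (show 0 < k by omega)
    have h1 := hCk k hk1
    have h2 : Real.log (oddWieferichExcess q k) < Real.log C + ε / (2 * Real.log q) * k * Real.log q := by
      have := Real.log_lt_log (hE0 k) h1
      rw [Real.log_mul hC.ne' (Real.rpow_pos_of_pos hq0 _).ne', Real.log_rpow hq0] at this
      linarith
    have h3 : ε / (2 * Real.log q) * k * Real.log q = (ε / 2) * k := by
      field_simp
    rw [h3] at h2
    rw [Real.dist_eq, sub_zero, abs_of_nonneg (div_nonneg (hlog0 k) hkR.le), div_lt_iff₀ hkR]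
    have hNk : 2 * |Real.log C| / ε < k := lt_of_lt_of_le hN (by exact_mod_cast (by omega : N ≤ k))
    rw [div_lt_iff₀ hε] at hNk
    have hC' : Real.log C ≤ |Real.log C| := le_abs_self _
    nlinarith
  · intro h δ hδ
    rw [Metric.tendsto_atTop] at h
    obtain ⟨N, hN⟩ := h (δ * Real.log q) (by positivity)
    set B : ℝ := (∑ j ∈ Finset.range (N + 1), (oddWieferichExcess q j : ℝ)) + 2 with hB
    have hBsum0 : 0 ≤ ∑ j ∈ Finset.range (N + 1), (oddWieferichExcess q j : ℝ) :=
      Finset.sum_nonneg fun j _ => Nat.cast_nonneg _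
    have hB1 : 1 < B := by rw [hB]; linarith
    have hB0 : 0 < B := by linarith
    refine ⟨B, hB0, fun k hk => ?_⟩
    have hQ1 : (1 : ℝ) ≤ (q : ℝ) ^ (δ * k) := Real.one_le_rpow hq1.le (by positivity)
    have hQ0 : (0 : ℝ) < (q : ℝ) ^ (δ * k) := by positivity
    by_cases hkN : N ≤ k
    · have hkR : (0 : ℝ) < k := by exact_mod_cast (show 0 < k by omega)
      have h1 := hN k hkN
      rw [Real.dist_eq, sub_zero, abs_of_nonneg (div_nonneg (hlog0 k) hkR.le),
        div_lt_iff₀ hkR] at h1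
      -- log E_W < δ log q · k  ⟹  E_W < q^(δ k)
      have hE : (oddWieferichExcess q k : ℝ) < (q : ℝ) ^ (δ * k) := by
        have e1 : (oddWieferichExcess q k : ℝ) = Real.exp (Real.log (oddWieferichExcess q k)) :=
          (Real.exp_log (hE0 k)).symm
        have e2 : (q : ℝ) ^ (δ * k) = Real.exp (Real.log q * (δ * k)) := Real.rpow_def_of_pos hq0 _
        rw [e1, e2]
        apply Real.exp_lt_exp.mpr
        have : Real.log q * (δ * k) = δ * Real.log q * k := by ring
        rw [this]
        exact h1
      calc (oddWieferichExcess q k : ℝ) < (q : ℝ) ^ (δ * k) := hE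
        _ = 1 * (q : ℝ) ^ (δ * k) := (one_mul _).symm
        _ ≤ B * (q : ℝ) ^ (δ * k) := mul_le_mul_of_nonneg_right hB1.le hQ0.le
    · have hkmem : k ∈ Finset.range (N + 1) := Finset.mem_range.mpr (by omega)
      have hle : (oddWieferichExcess q k : ℝ) ≤ ∑ j ∈ Finset.range (N + 1), (oddWieferichExcess q j : ℝ) :=
        Finset.single_le_sum (fun j _ => Nat.cast_nonneg _) hkmem
      calc (oddWieferichExcess q k : ℝ) ≤ ∑ j ∈ Finset.range (N + 1), (oddWieferichExcess q j : ℝ) := hle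
        _ < B := by rw [hB]; linarith
        _ ≤ B * (q : ℝ) ^ (δ * k) := le_mul_of_one_le_right hB0.le hQ1


/-- EXACT REFORMULATION (PROVED): crux at `q` ⟺ `(1/k)·Σ_{d ∣ k} E_q(d) → 0`, i.e. the `μ_k`-averages of the
level fractions tend to `0` (equivalently: for every `δ > 0` the δ-bad levels `B_δ = {d : ε_q(d) > δ}` are
`μ_k`-null as `k → ∞`; card lte-wieferich-transfer's C⁺ is "`B_δ` finite"). -/
theorem PPRAt_iff_levelAverage {q : ℕ} (hq : q.Prime) :
    (∀ ε : ℝ, 0 < ε → PPRAt q ε) ↔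
      Filter.Tendsto (fun k : ℕ => (∑ d ∈ k.divisors, levelExcess q d) / (k : ℝ))
        Filter.atTop (nhds 0) := by
  have hfun : (fun k : ℕ => (∑ d ∈ k.divisors, levelExcess q d) / (k : ℝ)) =
      (fun k : ℕ => Real.log (oddWieferichExcess q k) / (k : ℝ)) := by
    funext k
    rcases Nat.eq_zero_or_pos k with rfl | hk
    · simp
    · rw [log_oddWieferichExcess_eq_sum_levelExcess hq hk]
  rw [hfun, PPRAt_iff_wieferichSparse hq]
  exact wieferichSparse_iff_tendsto hq

/-- A proper divisor is at most half. -/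
theorem two_mul_le_of_dvd_of_ne {d n : ℕ} (hn : 0 < n) (hd : d ∣ n) (hne : d ≠ n) : 2 * d ≤ n := by
  obtain ⟨c, hc⟩ := hd
  have hc0 : c ≠ 0 := by rintro rfl; simp at hc; omega
  have hc1 : c ≠ 1 := by rintro rfl; simp at hc; exact hne hc.symm
  have hc2 : 2 ≤ c := by omega
  calc 2 * d = d * 2 := by ring
    _ ≤ d * c := Nat.mul_le_mul_left d hc2
    _ = n := hc.symm

/-- `lcm ≤ product` for a finset of positive naturals. -/
theorem lcm_le_prod {T : Finset ℕ} (f : ℕ → ℕ) (hpos : ∀ p ∈ T, 0 < f p) : T.lcm f ≤ ∏ p ∈ T, f p := by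
  apply Nat.le_of_dvd (Finset.prod_pos hpos)
  exact Finset.lcm_dvd fun b hb => Finset.dvd_prod_of_mem f hb

/-- COMBINATORIAL CORE: orders dividing `p − 1` of `2m` odd primes have an lcm at least `2^{m−1}` times smaller
than the product of the primes. -/
theorem pow_mul_lcm_le_prod {T : Finset ℕ} {m : ℕ} (hcard : T.card = 2 * m) (d : ℕ → ℕ)
    (hT : ∀ p ∈ T, 3 ≤ p ∧ 0 < d p ∧ d p ∣ p - 1 ∧ ¬ 2 ∣ p) :
    2 ^ (m - 1) * T.lcm d ≤ ∏ p ∈ T, p := by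
  classical
  set A := T.filter (fun p => d p = p - 1) with hA
  set B := T.filter (fun p => ¬ d p = p - 1) with hB
  have hcardAB : A.card + B.card = 2 * m := by
    rw [hA, hB, Finset.card_filter_add_card_filter_not]; exact hcard
  have hprodT : (∏ p ∈ A, p) * (∏ p ∈ B, p) = ∏ p ∈ T, p := by
    rw [hA, hB]; exact Finset.prod_filter_mul_prod_filter_not T _ _
  have hApos : 0 < ∏ p ∈ A, p := Finset.prod_pos fun p hp => by
    have := (hT p (Finset.mem_filter.mp hp).1).1; omega
  have hBpos : 0 < ∏ p ∈ B, p := Finset.prod_pos fun p hp => by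
    have := (hT p (Finset.mem_filter.mp hp).1).1; omega
  -- T.lcm d divides (A.lcm d) * (B.lcm d)
  have hsplit : T.lcm d ∣ A.lcm d * B.lcm d := by
    apply Finset.lcm_dvd
    intro p hp
    by_cases h : d p = p - 1
    · have hpA : p ∈ A := Finset.mem_filter.mpr ⟨hp, h⟩
      exact dvd_mul_of_dvd_left (Finset.dvd_lcm hpA) _
    · have hpB : p ∈ B := Finset.mem_filter.mpr ⟨hp, h⟩
      exact dvd_mul_of_dvd_right (Finset.dvd_lcm hpB) _
  -- B part: 2^{|B|} * B.lcm d ≤ ∏_B p  (each d p ≤ (p-1)/2)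
  have hBd : ∀ p ∈ B, 0 < d p ∧ 2 * d p ≤ p := by
    intro p hp
    obtain ⟨hpT, hne⟩ := Finset.mem_filter.mp hp
    obtain ⟨hp3, hdpos, hdvd, -⟩ := hT p hpT
    refine ⟨hdpos, ?_⟩
    have := two_mul_le_of_dvd_of_ne (by omega) hdvd hne
    omega
  have hBbound : 2 ^ B.card * B.lcm d ≤ ∏ p ∈ B, p := by
    have h1 : B.lcm d ≤ ∏ p ∈ B, d p := lcm_le_prod d fun p hp => (hBd p hp).1
    have h2 : ∏ p ∈ B, (2 * d p) ≤ ∏ p ∈ B, p := Finset.prod_le_prod' fun p hp => (hBd p hp).2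
    have h3 : ∏ p ∈ B, (2 * d p) = 2 ^ B.card * ∏ p ∈ B, d p := by
      rw [Finset.prod_mul_distrib, Finset.prod_const]
    calc 2 ^ B.card * B.lcm d ≤ 2 ^ B.card * ∏ p ∈ B, d p := Nat.mul_le_mul_left _ h1
      _ = ∏ p ∈ B, (2 * d p) := h3.symm
      _ ≤ ∏ p ∈ B, p := h2
  -- A part: 2^{|A|} * A.lcm d ≤ 2 * ∏_A p  (all d p = p - 1 even)
  set g : ℕ → ℕ := fun p => (p - 1) / 2 with hg
  have hAd : ∀ p ∈ A, d p = 2 * g p ∧ 0 < g p ∧ 2 * g p ≤ p := by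
    intro p hp
    obtain ⟨hpT, heq⟩ := Finset.mem_filter.mp hp
    obtain ⟨hp3, hdpos, -, hodd⟩ := hT p hpT
    have heven : 2 ∣ p - 1 := by omega
    have hg' : g p = (p - 1) / 2 := rfl
    refine ⟨?_, ?_, ?_⟩
    · rw [heq, hg']; omega
    · rw [hg']; omega
    · rw [hg']; omega
  have hAbound : 2 ^ A.card * A.lcm d ≤ 2 * ∏ p ∈ A, p := by
    have h1 : A.lcm d ∣ 2 * A.lcm g := by
      apply Finset.lcm_dvd
      intro p hp
      rw [(hAd p hp).1]
      exact mul_dvd_mul_left 2 (Finset.dvd_lcm hp)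
    have hgpos : 0 < A.lcm g := by
      rw [Nat.pos_iff_ne_zero, Ne, Finset.lcm_eq_zero_iff]
      rintro ⟨p, hp, h0⟩
      have := (hAd p hp).2.1
      omega
    have h2 : A.lcm d ≤ 2 * A.lcm g := Nat.le_of_dvd (by omega) h1
    have h3 : A.lcm g ≤ ∏ p ∈ A, g p := lcm_le_prod g fun p hp => (hAd p hp).2.1
    have h4 : ∏ p ∈ A, (2 * g p) ≤ ∏ p ∈ A, p := Finset.prod_le_prod' fun p hp => (hAd p hp).2.2
    have h5 : ∏ p ∈ A, (2 * g p) = 2 ^ A.card * ∏ p ∈ A, g p := by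
      rw [Finset.prod_mul_distrib, Finset.prod_const]
    calc 2 ^ A.card * A.lcm d ≤ 2 ^ A.card * (2 * A.lcm g) := Nat.mul_le_mul_left _ h2
      _ = 2 * (2 ^ A.card * A.lcm g) := by ring
      _ ≤ 2 * (2 ^ A.card * ∏ p ∈ A, g p) := by
          apply Nat.mul_le_mul_left; exact Nat.mul_le_mul_left _ h3
      _ = 2 * ∏ p ∈ A, (2 * g p) := by rw [h5]
      _ ≤ 2 * ∏ p ∈ A, p := Nat.mul_le_mul_left _ h4
  -- combine: 2^{|A|+|B|} * T.lcm d ≤ 2 * ∏_T p, hence 2^{2m-1} * lcm ≤ ∏_T p ... we only need 2^{m-1}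
  have hApos' : 0 < A.lcm d := by
    rw [Nat.pos_iff_ne_zero, Ne, Finset.lcm_eq_zero_iff]
    rintro ⟨p, hp, h0⟩
    have := (hT p (Finset.mem_filter.mp hp).1).2.1
    omega
  have hBpos' : 0 < B.lcm d := by
    rw [Nat.pos_iff_ne_zero, Ne, Finset.lcm_eq_zero_iff]
    rintro ⟨p, hp, h0⟩
    have := (hT p (Finset.mem_filter.mp hp).1).2.1
    omega
  have hTle : T.lcm d ≤ A.lcm d * B.lcm d := Nat.le_of_dvd (Nat.mul_pos hApos' hBpos') hsplit
  have hmain : 2 ^ (A.card + B.card) * T.lcm d ≤ 2 * ∏ p ∈ T, p := by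
    calc 2 ^ (A.card + B.card) * T.lcm d
        ≤ 2 ^ (A.card + B.card) * (A.lcm d * B.lcm d) := Nat.mul_le_mul_left _ hTle
      _ = (2 ^ A.card * A.lcm d) * (2 ^ B.card * B.lcm d) := by rw [pow_add]; ring
      _ ≤ (2 * ∏ p ∈ A, p) * (∏ p ∈ B, p) := Nat.mul_le_mul hAbound hBbound
      _ = 2 * ∏ p ∈ T, p := by rw [← hprodT]; ring
  -- 2^(m-1) * 2 ≤ 2^(2m) when m ≥ 1; handle m = 0 separately
  rcases Nat.eq_zero_or_pos m with rfl | hm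
  · simp
    have hTpos : 0 < T.lcm d ∨ True := Or.inr trivial
    -- T.card = 0 so T = ∅ and lcm = 1, prod = 1
    have hT0 : T = ∅ := Finset.card_eq_zero.mp (by omega)
    subst hT0
    simp
  · rw [hcardAB] at hmain
    have hpow : 2 ^ (m - 1) * 2 ≤ 2 ^ (2 * m) := by
      rw [← pow_succ]
      apply Nat.pow_le_pow_right (by norm_num)
      omega
    have hP := Finset.prod_pos (s := T) (f := fun p => p) fun p hp => by have := (hT p hp).1; omega
    -- 2^(m-1) * lcm * 2 ≤ 2^(2m) * lcm ≤ 2 * prod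
    have h1 : 2 ^ (m - 1) * T.lcm d * 2 ≤ 2 ^ (2 * m) * T.lcm d := by
      calc 2 ^ (m - 1) * T.lcm d * 2 = (2 ^ (m - 1) * 2) * T.lcm d := by ring
        _ ≤ 2 ^ (2 * m) * T.lcm d := Nat.mul_le_mul_right _ hpow
    have h2 : 2 ^ (m - 1) * T.lcm d * 2 ≤ 2 * ∏ p ∈ T, p := le_trans h1 hmain
    omega


/-- TIGHTNESS / BOTTOM OF THE LOSS DIAL (PROVED; settles the `A = 1` end left open in `Disproof` §7 and gives the
converse of §9 `PPRAt_of_finite_wieferich` at linear loss): LINEAR loss `q^k < C·k·rad(1·(q^k−1)·q^k)` at a prime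
base `q` holds IFF `q` has only FINITELY many Wieferich primes. `⟸`: `E_W` bounded and the upper sandwich.
`⟹`: `2m` odd Wieferich primes, `k := lcm` of their orders; `E_W(q,k) ≥ ∏ p_i` while `2^{m−1}·k ≤ ∏ p_i`
(`pow_mul_lcm_le_prod`: index-1 primes have even order `p − 1`, sharing the factor `2`; proper-divisor orders are
`≤ (p−1)/2`). Since `W_q` is believed infinite (`Σ 1/p`), the true loss is believed strictly super-linear. -/
theorem linearLoss_iff_finite_wieferich {q : ℕ} (hq : q.Prime) :
    (∃ C : ℝ, ∀ k : ℕ, 1 ≤ k →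
        ((q ^ k : ℕ) : ℝ) < C * (k : ℝ) * ((rad 1 (q ^ k - 1) (q ^ k) : ℕ) : ℝ)) ↔
      {p : ℕ | p.Prime ∧ IsWieferich q p}.Finite := by
  classical
  have hq2 := hq.two_le
  have hq0 : (0 : ℝ) < q := by exact_mod_cast hq.pos
  constructor
  · -- (⟹) by contraposition: infinitely many Wieferich primes defeat every linear constant
    intro ⟨C, hC⟩
    by_contra hinf
    rw [← Set.not_infinite, not_not] at hinf
    -- C > 0 from k = 1
    have hC0 : 0 < C := by
      have h := hC 1 le_rfl
      have hRpos : (0 : ℝ) < ((rad 1 (q ^ 1 - 1) (q ^ 1) : ℕ) : ℝ) := by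
        have := two_le_rad_family hq2 (le_refl 1)
        exact_mod_cast (by omega : 0 < rad 1 (q ^ 1 - 1) (q ^ 1))
      have hqk : (0 : ℝ) < ((q ^ 1 : ℕ) : ℝ) := by exact_mod_cast pow_pos hq.pos 1
      by_contra hle
      push_neg at hle
      have : C * ((1 : ℕ) : ℝ) * ((rad 1 (q ^ 1 - 1) (q ^ 1) : ℕ) : ℝ) ≤ 0 := by
        have : C * ((1 : ℕ) : ℝ) ≤ 0 := by simp; exact hle
        exact mul_nonpos_of_nonpos_of_nonneg this hRpos.le
      linarith
    -- choose m with 2^(m-1) > C q : take m > C q + 1, then 2^(m-1) ≥ m > Cq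
    obtain ⟨m, hm⟩ := exists_nat_gt (C * q + 1)
    have hm1 : 1 ≤ m := by
      by_contra h
      push_neg at h
      interval_cases m
      have : (0 : ℝ) < C * q := mul_pos hC0 hq0
      simp at hm; linarith
    have hpow_m : (m : ℝ) ≤ (2 : ℝ) ^ (m - 1) := by
      have : m ≤ 2 ^ (m - 1) := by
        have h := Nat.lt_two_pow_self (n := m - 1)
        omega
      exact_mod_cast this
    -- an infinite supply of odd Wieferich primes not dividing q
    set W : Set ℕ := {p : ℕ | p.Prime ∧ IsWieferich q p} with hW
    set F : Set ℕ := {p : ℕ | p ≤ q} with hF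
    have hFfin : F.Finite := Set.finite_le_nat q
    have hW' : (W \ F).Infinite := hinf.sdiff hFfin
    obtain ⟨T, hTsub, hTcard⟩ := hW'.exists_subset_card_eq (2 * m)
    have hTmem : ∀ p ∈ T, p.Prime ∧ IsWieferich q p ∧ q < p := by
      intro p hp
      have := hTsub (Finset.mem_coe.mpr hp)
      simp only [Set.mem_sdiff, hW, hF, Set.mem_setOf_eq, not_le] at this
      exact ⟨this.1.1, this.1.2, this.2⟩
    have hTfacts : ∀ p ∈ T, p.Prime ∧ p ≠ 2 ∧ ¬ p ∣ q ∧ 2 ≤ wieferichLevel q p ∧ 0 < ordMod q p := by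
      intro p hp
      obtain ⟨hpr, hW, hqp⟩ := hTmem p hp
      have hp2 : p ≠ 2 := by omega
      have hpq : ¬ p ∣ q := fun h => by have := Nat.le_of_dvd hq.pos h; omega
      refine ⟨hpr, hp2, hpq, ?_, ordMod_pos hpr hpq⟩
      exact (isWieferich_iff_two_le_wieferichLevel hq2 hpr hp2 hpq).mp hW
    -- k := lcm of the orders
    set k : ℕ := T.lcm (ordMod q) with hk
    have hkpos : 0 < k := by
      rw [hk, Nat.pos_iff_ne_zero, Ne, Finset.lcm_eq_zero_iff]
      rintro ⟨p, hp, h0⟩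
      have := (hTfacts p hp).2.2.2.2
      omega
    have hk1 : 1 ≤ k := hkpos
    -- every p ∈ T divides E_W(q,k)
    have hn : q ^ k - 1 ≠ 0 := by have := two_le_pow hq2 hk1; omega
    have hE0 := (oddWieferichExcess_pos q k).ne'
    have hdvdE : ∀ p ∈ T, p ^ 1 ∣ oddWieferichExcess q k := by
      intro p hp
      obtain ⟨hpr, hp2, hpq, hWp, hdpos⟩ := hTfacts p hp
      have hdk : ordMod q p ∣ k := Finset.dvd_lcm hp
      have hpk : p ∣ q ^ k - 1 := (dvd_pow_sub_one_iff_ordMod_dvd hpr (by omega) k).mpr hdk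
      have hmem : p ∈ (q ^ k - 1).primeFactors.erase 2 :=
        Finset.mem_erase.mpr ⟨hp2, Nat.mem_primeFactors.mpr ⟨hpr, hpk, hn⟩⟩
      have h1 : p ^ (wieferichLevel q p - 1) ∣ oddWieferichExcess q k := by
        unfold oddWieferichExcess
        exact Finset.dvd_prod_of_mem (fun r => r ^ (wieferichLevel q r - 1)) hmem
      rw [pow_one]
      exact dvd_trans (dvd_pow_self p (by omega)) h1
    have hprod_dvd : ∏ p ∈ T, p ^ 1 ∣ oddWieferichExcess q k :=
      prod_prime_pow_dvd_of_forall_dvd (fun r hr => (hTfacts r hr).1) (fun _ => 1) hE0 hdvdE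
    have hprod_dvd' : ∏ p ∈ T, p ∣ oddWieferichExcess q k := by
      have : ∏ p ∈ T, p ^ 1 = ∏ p ∈ T, p := Finset.prod_congr rfl fun p _ => pow_one p
      rwa [this] at hprod_dvd
    have hPle : ∏ p ∈ T, p ≤ oddWieferichExcess q k := Nat.le_of_dvd (oddWieferichExcess_pos q k) hprod_dvd'
    -- lower bound: (∏ p) * rad(q^k-1) ≤ E_W * rad ≤ q^k - 1 < q^k  (in ℕ)
    have hsand := (oddWieferichExcess_sandwich hq hk1).1
    have hlow : (∏ p ∈ T, p) * radical (q ^ k - 1) < q ^ k := by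
      calc (∏ p ∈ T, p) * radical (q ^ k - 1) ≤ oddWieferichExcess q k * radical (q ^ k - 1) :=
            Nat.mul_le_mul_right _ hPle
        _ ≤ q ^ k - 1 := hsand
        _ < q ^ k := Nat.sub_lt (pow_pos hq.pos k) one_pos
    -- upper bound from linear loss: q^k < C k rad_fam = C k (rad * q)
    have hup := hC k hk1
    rw [rad_family_eq hq hk1] at hup
    -- combinatorial core: 2^(m-1) * k ≤ ∏ p
    have hcomb : 2 ^ (m - 1) * k ≤ ∏ p ∈ T, p := by
      rw [hk]
      apply pow_mul_lcm_le_prod hTcard (ordMod q)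
      intro p hp
      obtain ⟨hpr, hp2, hpq, -, hdpos⟩ := hTfacts p hp
      have hp3 : 3 ≤ p := by have := hpr.two_le; omega
      refine ⟨hp3, hdpos, ordMod_dvd_sub_one hpr hpq, ?_⟩
      intro h2
      have := (Nat.prime_dvd_prime_iff_eq Nat.prime_two hpr).mp h2
      omega
    -- now in ℝ:  2^(m-1) k rad ≤ (∏p) rad < q^k < C k rad q   ⟹  2^(m-1) < C q, contradiction
    have hR0 : (0 : ℝ) < ((radical (q ^ k - 1) : ℕ) : ℝ) := by
      exact_mod_cast Nat.pos_of_ne_zero radical_ne_zero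
    have hkR : (0 : ℝ) < k := by exact_mod_cast hkpos
    have h1 : (2 : ℝ) ^ (m - 1) * k * ((radical (q ^ k - 1) : ℕ) : ℝ) < C * k * (((radical (q ^ k - 1) : ℕ) : ℝ) * q) := by
      have hlowR : ((∏ p ∈ T, p : ℕ) : ℝ) * ((radical (q ^ k - 1) : ℕ) : ℝ) < ((q ^ k : ℕ) : ℝ) := by
        exact_mod_cast hlow
      have hcombR : (2 : ℝ) ^ (m - 1) * k ≤ ((∏ p ∈ T, p : ℕ) : ℝ) := by
        exact_mod_cast hcomb
      have hupR : ((q ^ k : ℕ) : ℝ) < C * k * (((radical (q ^ k - 1) * q : ℕ) : ℝ)) := hup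
      push_cast at hupR
      calc (2 : ℝ) ^ (m - 1) * k * ((radical (q ^ k - 1) : ℕ) : ℝ)
          ≤ ((∏ p ∈ T, p : ℕ) : ℝ) * ((radical (q ^ k - 1) : ℕ) : ℝ) :=
            mul_le_mul_of_nonneg_right hcombR hR0.le
        _ < ((q ^ k : ℕ) : ℝ) := hlowR
        _ = (q : ℝ) ^ k := by push_cast; ring
        _ < C * k * (((radical (q ^ k - 1) : ℕ) : ℝ) * q) := by
            have : ((q : ℝ) ^ k) = ((q ^ k : ℕ) : ℝ) := by push_cast; ring
            rw [this]; exact_mod_cast hupR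
    have h2 : (2 : ℝ) ^ (m - 1) < C * q := by
      have hkr : (0 : ℝ) < k * ((radical (q ^ k - 1) : ℕ) : ℝ) := mul_pos hkR hR0
      have : (2 : ℝ) ^ (m - 1) * (k * ((radical (q ^ k - 1) : ℕ) : ℝ)) <
          C * q * (k * ((radical (q ^ k - 1) : ℕ) : ℝ)) := by
        have e1 : (2 : ℝ) ^ (m - 1) * (k * ((radical (q ^ k - 1) : ℕ) : ℝ)) =
            (2 : ℝ) ^ (m - 1) * k * ((radical (q ^ k - 1) : ℕ) : ℝ) := by ring
        have e2 : C * q * (k * ((radical (q ^ k - 1) : ℕ) : ℝ)) =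
            C * k * (((radical (q ^ k - 1) : ℕ) : ℝ) * q) := by ring
        rw [e1, e2]; exact h1
      exact lt_of_mul_lt_mul_right this hkr.le
    -- contradiction with m > C q + 1 and m ≤ 2^(m-1)
    linarith
  · -- (⟸) finitely many Wieferich primes: E_W bounded, then the upper sandwich
    intro hfin
    obtain ⟨N, hN⟩ := hfin.bddAbove
    have hlev : ∀ p : ℕ, p.Prime → p ≠ 2 → 2 ≤ wieferichLevel q p → p ≤ N := by
      intro p hp hp2 hW
      have hpq : ¬ p ∣ q := fun hdvd => by
        have h0 := wieferichLevel_eq_zero_of_dvd hp hq.one_lt.le hdvd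
        omega
      exact hN ⟨hp, (isWieferich_iff_two_le_wieferichLevel hq2 hp hp2 hpq).mpr hW⟩
    set B : ℕ := ∏ p ∈ (Finset.range (N + 1)).filter Nat.Prime, p ^ (wieferichLevel q p - 1) with hB
    refine ⟨((B : ℝ) * (2 : ℝ) ^ wieferichLevel q 2 + 1), fun k hk => ?_⟩
    have hE : oddWieferichExcess q k ≤ B := oddWieferichExcess_le_of_levels_bounded hlev
    have hsand := (oddWieferichExcess_sandwich hq hk).2
    -- q^k - 1 ≤ k * rad * E_W * 2^W ≤ k * rad * B * 2^W
    have h1 : q ^ k - 1 ≤ k * radical (q ^ k - 1) * B * 2 ^ wieferichLevel q 2 := by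
      calc q ^ k - 1 ≤ k * radical (q ^ k - 1) * oddWieferichExcess q k * 2 ^ wieferichLevel q 2 := hsand
        _ ≤ k * radical (q ^ k - 1) * B * 2 ^ wieferichLevel q 2 := by
            apply Nat.mul_le_mul_right
            exact Nat.mul_le_mul_left _ hE
    have hqk1 : 1 ≤ q ^ k := Nat.one_le_pow _ _ hq.pos
    have h2 : q ^ k ≤ k * radical (q ^ k - 1) * B * 2 ^ wieferichLevel q 2 + 1 := by omega
    rw [rad_family_eq hq hk]
    have hR1 : 1 ≤ radical (q ^ k - 1) := Nat.pos_of_ne_zero radical_ne_zero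
    -- in ℝ
    have h2R : ((q ^ k : ℕ) : ℝ) ≤ (k : ℝ) * ((radical (q ^ k - 1) : ℕ) : ℝ) * B * (2 : ℝ) ^ wieferichLevel q 2 + 1 := by
      exact_mod_cast h2
    have hkR : (1 : ℝ) ≤ k := by exact_mod_cast hk
    have hRR : (1 : ℝ) ≤ ((radical (q ^ k - 1) : ℕ) : ℝ) := by exact_mod_cast hR1
    have hqR : (2 : ℝ) ≤ q := by exact_mod_cast hq2
    have hB0 : (0 : ℝ) ≤ (B : ℝ) * (2 : ℝ) ^ wieferichLevel q 2 := by positivity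
    push_cast
    push_cast at h2R
    -- goal: q^k < (B 2^W + 1) * k * (rad * q)
    set X : ℝ := (k : ℝ) * ((radical (q ^ k - 1) : ℕ) : ℝ) with hX
    set Y : ℝ := (B : ℝ) * (2 : ℝ) ^ wieferichLevel q 2 with hY
    have hX1 : 1 ≤ X := by rw [hX]; nlinarith
    have hY0 : 0 ≤ Y := hB0
    have hXY : 0 ≤ X * Y := mul_nonneg (by linarith) hY0
    have h3 : (q : ℝ) ^ k ≤ X * Y + 1 := by
      have e : (k : ℝ) * ((radical (q ^ k - 1) : ℕ) : ℝ) * B * (2 : ℝ) ^ wieferichLevel q 2 = X * Y := by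
        rw [hX, hY]; ring
      linarith [h2R, e]
    have h4 : (Y + 1) * X * 2 ≤ (Y + 1) * X * q := by
      apply mul_le_mul_of_nonneg_left hqR
      positivity
    have h5 : ((B : ℝ) * (2 : ℝ) ^ wieferichLevel q 2 + 1) * k * (((radical (q ^ k - 1) : ℕ) : ℝ) * q)
        = (Y + 1) * X * q := by rw [hX, hY]; ring
    rw [h5]
    nlinarith


/-- INTERMEDIATE RUNGS OF THE DIAL (provable now by the same `M`-splitting): for `0 < a ≤ 1`,
`Σ_{W_q} (W_p − 1) log p / ord_p(q)^a < ∞ ⟹ log E_W(q,k) = o(k^a)` (`a = 1` is `wieferichSparse_of_wdc`;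
every `a > 0` is a.s.-true in the `1/p` model, while `a = 0` — finitely many Wieferich primes — is a.s.-false). -/
theorem excess_littleO_of_summable_pow {q : ℕ} (hq : q.Prime) {a : ℝ} (ha0 : 0 < a) (ha1 : a ≤ 1)
    (h : Summable (fun p : Nat.Primes =>
      ((wieferichLevel q p - 1 : ℕ) : ℝ) * Real.log p / (ordMod q p : ℝ) ^ a)) :
    ∀ ε : ℝ, 0 < ε → ∃ C : ℝ, ∀ k : ℕ, 1 ≤ k →
      Real.log (oddWieferichExcess q k) ≤ ε * (k : ℝ) ^ a + C := by
  sorry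

end Summit.ABC.ABC.Cruxes.PrimePowerRadical.Brjuno
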